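import Summits.BirchSwinnertonDyer.Rank1Residual.Additive.CondExpFourUnitPartLawThreeOfTableII
import Literature.NumberTheory.EllipticCurves.RootNumberTableThreeLocalReadingsProofs
import Literature.NumberTheory.EllipticCurves.RootNumberTableThreeAdmissibleProofs
import HarnessLib

/-!
# LAW L-w3, table layer: the `W₃` column of Rizzo's Table II on the four `v(N) = 4` rows, read on
# rational invariants, and the residue kernels of the Kodaira-`IV` / `IV*` rows

Cell `pub/bsd-wall` (D-0145 line `route-BirchSwinnertonDyer-CyclotomicUntwist`), seat `bsd-line-cycu-p4`
(width seat 4, gen 4). Helper toward the cruxes K1 `PSRankOneLowerHalfAtThree`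
(stmt-BirchSwinnertonDyer-21580) and K2 `PSRankOneUpperHalfAtThree` (stmt-21581): the TABLE LAYER of the
law "`W₃ = −1` exactly on the principal-series `IV`/`IV*` rows" proved on curves in the sequel
`CyclotomicUntwistPSRootNumberThree.lean`. THEOREMS ONLY (no definition, no named fact, no `sorry`);
nothing about curves here; BSD is not proved by this file and no crux is.

Source: O. G. Rizzo, Compositio Math. 136 (2003), Table II (p. 4), transcribed in the tree as
`Literature.NumberTheory.EllipticCurves.Rizzo.tableII` (`RootNumberTableThree.lean`, validated there on
the 3 064 705 curves of conductor `< 500 000`). The cyclic wild cell at `3` (`f₃ = 4`) meets exactly the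
four rows with `v(N) = 4` (`rizzo_tableII_condExp_eq_four`, b2b file `CondExpFourUnitPartLawThreeOfTableII`):

| reduced triple `(v₃c₄, v₃c₆, v₃Δ)` | Kodaira | `v₃(Δ_min)` | `W₃` (Table II) |
|---|---|---|---|
| `(2, 3, 4)` | `II` | `4` | `+1` |
| `(3, 5, 6)` | `IV` | `6` | `+1` iff `c₄' ≡ 2 (mod 3)` |
| `(4, 6, 10)` | `IV*` | `10` | `+1` iff `c₆' ≡ ±2 (mod 9)` |
| ★`(1, 2, 0)` (minimal `(5, 8, 12)`) | `II*` | `12` | `+1` |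

* §1 `tableII_w_row_2_3_4` / `_1_2_0` / `_3_5_6` / `_4_6_10` — the four `W₃` entries (evaluation of the
  transcription, in the style of `RootNumberTableThreeKodairaRowsProofs`).
* §2 `rows_of_condExpOfInvariants_eq_four_of_mem` — `v(N) = 4` and `v₃(Δ) ∈ {4, 6, 10, 12}` pin the
  triple (the shift is solved for: `m = 0`, or `m = 1` on the starred row); `w3OfInvariants_row_*` —
  `Rizzo.w3OfInvariants` on invariants with these valuations.
* §3 the residue kernels of the `c`-relation `1728·Δ = c₄³ − c₆²` on the two conditional rows:
  `emod_three_eq_of_kernel_IV` (`64·Δ′ = c₄'³ − 3c₆'² ⟹ c₄' ≡ Δ′ (mod 3)`) and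
  `emod_nine_iff_of_kernel_IVstar` (`192·Δ′ = c₄'³ − c₆'²`, `3 ∤ c₄' c₆'` ⟹ (`c₆' ≡ ±2 (mod 9)` iff
  `Δ′ ≡ 2 (mod 3)`); `decide` over `ℤ/9`), plus `res9_intCast_eq` (Table II's residue of an integer).
  So on both conditional rows Table II's condition is `Δ′ ≡ 2 (mod 3)`: `Δ_min` NOT a `3`-adic square.

References: O. G. Rizzo, *Average root numbers for a nonconstant family of elliptic curves*, Compositio
Math. 136 (2003) 1–23, §1.1–1.2, Table II [Rizzo2003]; E. Halberstadt, C. R. Acad. Sci. Paris 326 (1998)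
1047–1052 [Halberstadt1998]; I. Papadopoulos, J. Number Theory 44 (1993), Table (p = 3) [Papadopoulos1993].
-/

open scoped Classical

open Literature.NumberTheory.EllipticCurves Summit.BirchSwinnertonDyer.Rank1Residual.Additive

-- single-conjunct summit: `Summit.BirchSwinnertonDyer.BirchSwinnertonDyer.…` repeats the name by design
set_option linter.dupNamespace false
set_option autoImplicit false

namespace Summit.BirchSwinnertonDyer.BirchSwinnertonDyer.Theorems.PSRootNumberThreeTable

/-! ### §1 The `W₃` column of Table II on the four `v(N) = 4` rows (evaluation of the transcription) -/

section Table

/-- Row `(2,3,4)` (Kodaira `II`, `v(N) = 4`): `W₃ = +1`, no special condition.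
[cite: Rizzo2003, Table II (p. 4), row (2,3,4), column W₃] -/
theorem tableII_w_row_2_3_4 (x y z : ℤ) : (Rizzo.tableII 2 3 4 x y z).2.2 = 1 := by
  unfold Rizzo.tableII; dsimp only
  simp (config := { decide := true }) only [ite_true, ite_false, false_and, and_false]

/-- Row ★`(1,2,0)` (the reduced triple of a minimal `(5,8,12)`, Kodaira `II*`, `v(N) = 4`): `W₃ = +1`.
[cite: Rizzo2003, Table II (p. 4), row (1,2,0), column W₃] -/
theorem tableII_w_row_1_2_0 (x y z : ℤ) : (Rizzo.tableII 1 2 0 x y z).2.2 = 1 := by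
  unfold Rizzo.tableII; dsimp only
  simp (config := { decide := true }) only [ite_true, ite_false, false_and, and_false]

/-- Row `(3,5,6)` (Kodaira `IV`, `v(N) = 4`): `W₃ = +1` iff `c₄' ≡ 2 (mod 3)`.
[cite: Rizzo2003, Table II (p. 4), row (3,5,6), column W₃] -/
theorem tableII_w_row_3_5_6 (x y z : ℤ) :
    (Rizzo.tableII 3 5 6 x y z).2.2 = if x % 3 = 2 then 1 else -1 := by
  unfold Rizzo.tableII; dsimp only
  simp (config := { decide := true }) only [ite_true, ite_false, false_and, and_false]

/-- Row `(4,6,10)` (Kodaira `IV*`, `v(N) = 4`): `W₃ = +1` iff `c₆' ≡ ±2 (mod 9)`.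
[cite: Rizzo2003, Table II (p. 4), row (4,6,10), column W₃] -/
theorem tableII_w_row_4_6_10 (x y z : ℤ) :
    (Rizzo.tableII 4 6 10 x y z).2.2 = if y % 9 = 2 ∨ y % 9 = 7 then 1 else -1 := by
  unfold Rizzo.tableII; dsimp only
  simp (config := { decide := true }) only [ite_true, ite_false, false_and, and_false]

end Table

/-! ### §2 Table II read on rational invariants with pinned valuations -/

section Invariants

/-- `val3` of a non-zero rational is its `3`-adic valuation. [cite: Rizzo2003, §1.1 (p. 3)] -/
theorem val3_eq_coe {q : ℚ} (hq : q ≠ 0) : Rizzo.val3 q = ((padicValRat 3 q : ℤ) : WithTop ℤ) := by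
  simp [Rizzo.val3, hq]

/-- **`v(N) = 4` and `v₃(Δ) ∈ {4, 6, 10, 12}` pin the triple `(v₃c₄, v₃c₆, v₃Δ)`** to `(2,3,4)`, `(3,5,6)`,
`(4,6,10)` (shift `0`) or `(5,8,12)` (the starred row `(1,2,0)` after the shift `m = 1`): of the four
`v(N) = 4` rows (`rizzo_tableII_condExp_eq_four`) exactly one is compatible with each value of `v₃(Δ)`
(the shift is solved for; no minimality is used). The cases `v₃Δ ∈ {6, 12}` are
`rows_of_condExpOfInvariants_eq_four` of the b2b file; all four are redone here uniformly.
[cite: Rizzo2003, Table II (p. 4) and §1.1–1.2 (pp. 3–4)] -/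
theorem rows_of_condExpOfInvariants_eq_four_of_mem {c₄ c₆ Δ : ℚ}
    (h : Rizzo.condExpOfInvariants c₄ c₆ Δ = 4)
    (hv : padicValRat 3 Δ = 4 ∨ padicValRat 3 Δ = 6 ∨ padicValRat 3 Δ = 10 ∨ padicValRat 3 Δ = 12) :
    c₄ ≠ 0 ∧ c₆ ≠ 0 ∧
      ((padicValRat 3 c₄ = 2 ∧ padicValRat 3 c₆ = 3 ∧ padicValRat 3 Δ = 4) ∨
        (padicValRat 3 c₄ = 3 ∧ padicValRat 3 c₆ = 5 ∧ padicValRat 3 Δ = 6) ∨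
        (padicValRat 3 c₄ = 4 ∧ padicValRat 3 c₆ = 6 ∧ padicValRat 3 Δ = 10) ∨
        (padicValRat 3 c₄ = 5 ∧ padicValRat 3 c₆ = 8 ∧ padicValRat 3 Δ = 12)) := by
  unfold Rizzo.condExpOfInvariants Rizzo.ofInvariants at h
  dsimp only at h
  set m := KellockDokchitser.shift (padicValRat 3 Δ) (Rizzo.val3 c₆) (Rizzo.val3 c₄) with hm
  clear_value m
  by_cases hc4 : c₄ = 0
  · have hv4 : Rizzo.val3 c₄ = ⊤ := by simp [Rizzo.val3, hc4]
    rw [hv4, WithTop.map_top] at h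
    rcases rizzo_tableII_condExp_eq_four h with ⟨ha, -, -⟩ | ⟨ha, -, -⟩ | ⟨ha, -, -⟩ | ⟨ha, -, -⟩
    · exact absurd ha WithTop.top_ne_one
    · exact absurd ha (WithTop.top_ne_ofNat 2)
    · exact absurd ha (WithTop.top_ne_ofNat 3)
    · exact absurd ha (WithTop.top_ne_ofNat 4)
  by_cases hc6 : c₆ = 0
  · have hv6 : Rizzo.val3 c₆ = ⊤ := by simp [Rizzo.val3, hc6]
    rw [hv6, WithTop.map_top] at h
    rcases rizzo_tableII_condExp_eq_four h with ⟨-, hb, -⟩ | ⟨-, hb, -⟩ | ⟨-, hb, -⟩ | ⟨-, hb, -⟩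
    · exact absurd hb (WithTop.top_ne_ofNat 2)
    · exact absurd hb (WithTop.top_ne_ofNat 3)
    · exact absurd hb (WithTop.top_ne_ofNat 5)
    · exact absurd hb (WithTop.top_ne_ofNat 6)
  rw [val3_eq_coe hc4, val3_eq_coe hc6, WithTop.map_coe, WithTop.map_coe] at h
  refine ⟨hc4, hc6, ?_⟩
  rcases rizzo_tableII_condExp_eq_four h with
    ⟨ha, hb, hc⟩ | ⟨ha, hb, hc⟩ | ⟨ha, hb, hc⟩ | ⟨ha, hb, hc⟩
  all_goals simp only [WithTop.coe_eq_ofNat, WithTop.coe_eq_one] at ha hb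
  · right; right; right; omega
  · left; omega
  · right; left; omega
  · right; right; left; omega

/-- **Table II, column `W₃`, on the reduced triple with shift `0`.** If the `3`-adic valuations of
`q₄, q₆, qΔ` are `a, b, c` and `(a, b, c)` is already reduced, `Rizzo.w3OfInvariants q₄ q₆ qΔ` is the
`W₃` entry at `(a, b, c)` with the residues of the invariants. [cite: Rizzo2003, §1.1–1.2 (pp. 3–4) and Table II (p. 4), column W₃] -/
theorem w3OfInvariants_eq_of_shift_zero {q₄ q₆ qΔ : ℚ} {a b c : ℤ} (hq₄ : q₄ ≠ 0) (hq₆ : q₆ ≠ 0)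
    (h4 : padicValRat 3 q₄ = a) (h6 : padicValRat 3 q₆ = b) (hΔ : padicValRat 3 qΔ = c)
    (hs : KellockDokchitser.shift c (b : WithTop ℤ) (a : WithTop ℤ) = 0) :
    Rizzo.w3OfInvariants q₄ q₆ qΔ =
      (Rizzo.tableII (a : WithTop ℤ) (b : WithTop ℤ) c (Rizzo.res9 q₄) (Rizzo.res9 q₆) (Rizzo.res9 qΔ)).2.2 := by
  unfold Rizzo.w3OfInvariants Rizzo.ofInvariants
  dsimp only
  rw [val3_eq_coe hq₄, val3_eq_coe hq₆, h4, h6, hΔ, hs]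
  simp only [WithTop.map_coe, mul_zero, sub_zero]

/-- **Table II, column `W₃`, on the reduced triple with shift `1`** (the ★ row `(5,8,12) ↦ (1,2,0)`).
[cite: Rizzo2003, §1.1–1.2 (pp. 3–4) and Table II (p. 4), column W₃] -/
theorem w3OfInvariants_eq_of_shift_one {q₄ q₆ qΔ : ℚ} {a b c : ℤ} (hq₄ : q₄ ≠ 0) (hq₆ : q₆ ≠ 0)
    (h4 : padicValRat 3 q₄ = a) (h6 : padicValRat 3 q₆ = b) (hΔ : padicValRat 3 qΔ = c)
    (hs : KellockDokchitser.shift c (b : WithTop ℤ) (a : WithTop ℤ) = 1) :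
    Rizzo.w3OfInvariants q₄ q₆ qΔ =
      (Rizzo.tableII ((a - 4 : ℤ) : WithTop ℤ) ((b - 6 : ℤ) : WithTop ℤ) (c - 12)
        (Rizzo.res9 q₄) (Rizzo.res9 q₆) (Rizzo.res9 qΔ)).2.2 := by
  unfold Rizzo.w3OfInvariants Rizzo.ofInvariants
  dsimp only
  rw [val3_eq_coe hq₄, val3_eq_coe hq₆, h4, h6, hΔ, hs]
  simp only [WithTop.map_coe, mul_one]

/-- Row `(2,3,4)` on invariants: `W₃ = +1`. [cite: Rizzo2003, Table II (p. 4), row (2,3,4)] -/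
theorem w3OfInvariants_row_2_3_4 {q₄ q₆ qΔ : ℚ} (hq₄ : q₄ ≠ 0) (hq₆ : q₆ ≠ 0)
    (h4 : padicValRat 3 q₄ = 2) (h6 : padicValRat 3 q₆ = 3) (hΔ : padicValRat 3 qΔ = 4) :
    Rizzo.w3OfInvariants q₄ q₆ qΔ = 1 := by
  rw [w3OfInvariants_eq_of_shift_zero (a := 2) (b := 3) (c := 4) hq₄ hq₆ h4 h6 hΔ (by decide)]
  exact tableII_w_row_2_3_4 _ _ _

/-- Row `(3,5,6)` on invariants: `W₃ = +1` iff `c₄' ≡ 2 (mod 3)`. [cite: Rizzo2003, Table II (p. 4), row (3,5,6)] -/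
theorem w3OfInvariants_row_3_5_6 {q₄ q₆ qΔ : ℚ} (hq₄ : q₄ ≠ 0) (hq₆ : q₆ ≠ 0)
    (h4 : padicValRat 3 q₄ = 3) (h6 : padicValRat 3 q₆ = 5) (hΔ : padicValRat 3 qΔ = 6) :
    Rizzo.w3OfInvariants q₄ q₆ qΔ = if Rizzo.res9 q₄ % 3 = 2 then 1 else -1 := by
  rw [w3OfInvariants_eq_of_shift_zero (a := 3) (b := 5) (c := 6) hq₄ hq₆ h4 h6 hΔ (by decide)]
  exact tableII_w_row_3_5_6 _ _ _

/-- Row `(4,6,10)` on invariants: `W₃ = +1` iff `c₆' ≡ ±2 (mod 9)`. [cite: Rizzo2003, Table II (p. 4), row (4,6,10)] -/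
theorem w3OfInvariants_row_4_6_10 {q₄ q₆ qΔ : ℚ} (hq₄ : q₄ ≠ 0) (hq₆ : q₆ ≠ 0)
    (h4 : padicValRat 3 q₄ = 4) (h6 : padicValRat 3 q₆ = 6) (hΔ : padicValRat 3 qΔ = 10) :
    Rizzo.w3OfInvariants q₄ q₆ qΔ =
      if Rizzo.res9 q₆ % 9 = 2 ∨ Rizzo.res9 q₆ % 9 = 7 then 1 else -1 := by
  rw [w3OfInvariants_eq_of_shift_zero (a := 4) (b := 6) (c := 10) hq₄ hq₆ h4 h6 hΔ (by decide)]
  exact tableII_w_row_4_6_10 _ _ _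

/-- Row `(5,8,12)` (reduced: ★`(1,2,0)`) on invariants: `W₃ = +1`. [cite: Rizzo2003, Table II (p. 4), row (1,2,0)] -/
theorem w3OfInvariants_row_5_8_12 {q₄ q₆ qΔ : ℚ} (hq₄ : q₄ ≠ 0) (hq₆ : q₆ ≠ 0)
    (h4 : padicValRat 3 q₄ = 5) (h6 : padicValRat 3 q₆ = 8) (hΔ : padicValRat 3 qΔ = 12) :
    Rizzo.w3OfInvariants q₄ q₆ qΔ = 1 := by
  rw [w3OfInvariants_eq_of_shift_one (a := 5) (b := 8) (c := 12) hq₄ hq₆ h4 h6 hΔ (by decide)]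
  exact tableII_w_row_1_2_0 _ _ _

end Invariants

/-! ### §3 Arithmetic kernels: the `c`-relation `1728·Δ = c₄³ − c₆²` read modulo `3` and `9` -/

section Kernels

/-- `3`-free part of a non-zero integer: `z = 3^{v₃ z}·u` with `3 ∤ u`. [folklore] -/
theorem exists_eq_pow_mul_not_dvd {z : ℤ} (hz : z ≠ 0) :
    ∃ u : ℤ, z = 3 ^ padicValInt 3 z * u ∧ ¬ (3 : ℤ) ∣ u := by
  set v := padicValInt 3 z with hv
  obtain ⟨u, hu⟩ : (3 : ℤ) ^ v ∣ z := by exact_mod_cast padicValInt_dvd (p := 3) z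
  refine ⟨u, hu, ?_⟩
  rintro ⟨u', rfl⟩
  have h3 : (3 : ℤ) ^ (v + 1) ∣ z := ⟨u', by rw [hu]; ring⟩
  rcases (padicValInt_dvd_iff (p := 3) (v + 1) z).mp (by exact_mod_cast h3) with h | h
  · exact hz h
  · omega

/-- **`res9` of an integer**: if `C = 3ᵏ·u` and `v₃(C) = k`, Table II's residue `res9 C` (the prime-to-`3`
part read modulo `9`) is `u % 9`. [cite: Rizzo2003, p. 2 (notation x')] -/
theorem res9_intCast_eq {C u : ℤ} {k : ℕ} (hC : C = 3 ^ k * u) (hv : padicValRat 3 (C : ℚ) = k) :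
    Rizzo.res9 (C : ℚ) = u % 9 := by
  unfold Rizzo.res9 Rizzo.primeToThreePart
  have hq : (C : ℚ) / 3 ^ padicValRat 3 (C : ℚ) = ((u : ℤ) : ℚ) := by
    rw [hv, zpow_natCast, hC]
    push_cast
    exact mul_div_cancel_left₀ _ (pow_ne_zero _ (by norm_num))
  rw [hq]
  simp only [Rat.den_intCast, Rat.num_intCast, if_true]

/-- **Kernel of the `IV` row `(3,5,6)`**: `64·d = a³ − 3b²` ⟹ `a ≡ d (mod 3)` (`64 ≡ 1`, `a³ ≡ a`).
[folklore] -/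
theorem emod_three_eq_of_kernel_IV {a b d : ℤ} (h : 64 * d = a ^ 3 - 3 * b ^ 2) :
    a % 3 = d % 3 := by
  have h' := congrArg (Int.cast : ℤ → ZMod 3) h
  push_cast at h'
  have h64 : (64 : ZMod 3) = 1 := by decide
  have h3 : (3 : ZMod 3) = 0 := by decide
  rw [h64, one_mul, h3, zero_mul, sub_zero, ZMod.pow_card] at h'
  have hm := (ZMod.intCast_eq_intCast_iff a d 3).mp h'.symm
  unfold Int.ModEq at hm
  exact_mod_cast hm

/-- The `729` residue classes of the `IV*` row `(4,6,10)`: for units `x, y` of `ℤ/9` with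
`192·z = x³ − y²`, `y ≡ ±2 (mod 9)` iff `z ≡ 2 (mod 3)` (and otherwise `y ≡ ±4`, `z ≡ 1`). [folklore] -/
private theorem kernel_IVstar_zmod : ∀ x y z : ZMod 9,
    ZMod.castHom (show 3 ∣ 9 by norm_num) (ZMod 3) x ≠ 0 →
    ZMod.castHom (show 3 ∣ 9 by norm_num) (ZMod 3) y ≠ 0 →
    192 * z = x ^ 3 - y ^ 2 →
      ((y = 2 ∨ y = 7) ↔ ZMod.castHom (show 3 ∣ 9 by norm_num) (ZMod 3) z = 2) := by
  decide

/-- **Kernel of the `IV*` row `(4,6,10)`**: `192·d = a³ − b²` with `3 ∤ a`, `3 ∤ b` ⟹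
(`b ≡ ±2 (mod 9)` iff `d ≡ 2 (mod 3)`) — `a³ ≡ ±1`, `192 ≡ 3 (mod 9)`, and the squares of units modulo
`9` are `1, 4, 7`. [folklore] -/
theorem emod_nine_iff_of_kernel_IVstar {a b d : ℤ} (ha : ¬ (3 : ℤ) ∣ a) (hb : ¬ (3 : ℤ) ∣ b)
    (h : 192 * d = a ^ 3 - b ^ 2) : (b % 9 = 2 ∨ b % 9 = 7) ↔ d % 3 = 2 := by
  have ha' : ZMod.castHom (show 3 ∣ 9 by norm_num) (ZMod 3) (a : ZMod 9) ≠ 0 := by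
    rw [map_intCast, Ne, ZMod.intCast_zmod_eq_zero_iff_dvd]; exact_mod_cast ha
  have hb' : ZMod.castHom (show 3 ∣ 9 by norm_num) (ZMod 3) (b : ZMod 9) ≠ 0 := by
    rw [map_intCast, Ne, ZMod.intCast_zmod_eq_zero_iff_dvd]; exact_mod_cast hb
  have h' : (192 : ZMod 9) * (d : ZMod 9) = (a : ZMod 9) ^ 3 - (b : ZMod 9) ^ 2 := by
    have h'' := congrArg (Int.cast : ℤ → ZMod 9) h
    push_cast at h''
    exact h''
  have key := kernel_IVstar_zmod _ _ _ ha' hb' h'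
  rw [map_intCast] at key
  have e2 : ((b : ZMod 9) = 2) ↔ b % 9 = 2 := by
    rw [show (2 : ZMod 9) = ((2 : ℤ) : ZMod 9) by norm_num, ZMod.intCast_eq_intCast_iff]
    simp [Int.ModEq]
  have e7 : ((b : ZMod 9) = 7) ↔ b % 9 = 7 := by
    rw [show (7 : ZMod 9) = ((7 : ℤ) : ZMod 9) by norm_num, ZMod.intCast_eq_intCast_iff]
    simp [Int.ModEq]
  have e3 : ((d : ZMod 3) = 2) ↔ d % 3 = 2 := by
    rw [show (2 : ZMod 3) = ((2 : ℤ) : ZMod 3) by norm_num, ZMod.intCast_eq_intCast_iff]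
    simp [Int.ModEq]
  rw [e2, e7, e3] at key
  exact key

end Kernels

end Summit.BirchSwinnertonDyer.BirchSwinnertonDyer.Theorems.PSRootNumberThreeTable
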